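import Summits.QuantumFields.BalabanUV.Beta.CombRemainderParityAll
import Summits.QuantumFields.BalabanUV.Beta.FP.StepKernelWardDataReflTablesAn1
import Summits.QuantumFields.BalabanUV.Beta.FP.StepRecursionFeed

/-!
# `BalabanUV.Beta.FP.StepKernelWardDataRecord` — road «FP» for binder row D1, ROUTE T, (L4′) OF TID § F.10, OWNER #30d: **hW ∧ hR AT THE PINNED (III′) LITERAL (levels `…S2` … M‴ COMPOSED); (T0)(T1) DISCHARGED; #28 §5 RE-CUT TO (L1)(L2′)**

WHY (road «FP», ROUTE T, TID § F.10 (L4′); OWNER #30).  The (F1) END socket #28 `FP/StepRecursionFeed` §5 concludes M‴'s `htel : D1Tel Lc (JsB12CombShSym hLc N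
(symTablesAn1S2 3 Lc cΛ) cΛ cB) Jc` from the road's rows (L1)(L2′) AND an4's side binders (L4′) `hT0 hT1` — (T0)(T1) of the step kernels of the (III′) literal of
record.  Those follow (β-lead's `ScalewiseVectorSeam.scalewiseData_of_printed_flip` at an4's uniform decay `hdec_TbalOf`) from hW ∧ hR of the flipped step kernels,
which the row-D1 OWNER's ROOT chain F′ … M‴ (`CombChartJointEndTables` … `CombChartJointEndReflTablesAn1S2N`, `CombRemainderParityAll`) proves LETTER BY LETTER —
but only INSIDE `D1Drift`-concluding roots (`CombChartWardEnd` §2 ∕ `CombChartJointEnd` §3 are letter-relative).  Files #30a–#30d re-trace that chain with the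
conclusion replaced by hW ∧ hR (one TWIN theorem per root: same letters, same body, callee ↦ callee's twin, route binders dropped), ending at the pinned literal
with M‴'s own scalars only (`Odd Lc`, `2 ≤ Lc`, `2 ≤ N`, `hΛ`, `hcB`); #30d then DISCHARGES (L4′) and re-cuts #28 §5 to (L1)(L2′).

WHAT (this file).  §1 `wardRefl_JsB12CombShSym_an1TablesS2_of_locks_contact_splitLoc_hcomp` — the twin of `CombChartJointEndReflTablesAn1S2RD`'s root with the
SUBSTITUTION-ONLY levels `…An1S2` ∕ `…S2M` ∕ `…S2MW` ∕ `…S2MWV` ∕ `…S2MWVB` ∕ `…S2R` COMPOSED into one term over #30c's twin (an1's second-order tables, the `_sym`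
Ward∕reflection table letters, the `_comb` contact letters — every one BY NAME as in those roots); then the twins of `…S2Z`, `…S2N` (pinned) and of M‴
(`hRm0 := CombRemainderParityAll.hRm0_discharged`).  §2 `stepData_JsB12CombShSym_an1S2_pinned` (hTA ∧ (T0) ∧ (T1)), `stepT0_… ∕ stepT1_… ∕ stepTA_…`.
§3 `d1Tel_JcOf_of_kernel_laws_wStep_pinned`, `d1Tel_anchored_of_kernel_laws_wStep_pinned` (#28 §5 with `hT0 hT1` SUPPLIED), `d1Tel_anchored_of_stepRecursion_wStep_pinned`
(M‴'s `htel` from an4's `StepRecursion` at the canonical weight in ONE hypothesis, for any `Jc` anchored on `JcOf` at `m = 1`).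

HONEST DEPENDENCY (page 1, mandatory): continuum YM on T⁴ ⇐ BetaPertH ∧ nine spine estimates (0/9 proved); BetaPertH ⇐ (D1) ∧ (D4) ∧ CAP+tail;
G-an2-4 gates asym, D1 and NE2/3/4.  HONEST FRAMING (cell contract, verbatim): «discharging `BetaPertH` makes Bałaban's UV stability UNCONDITIONAL —
a real constructive-QFT result; it is NOT the continuum limit and NOT the Clay problem.»  ABSOLUTE RULE (cell charter, verbatim): «No internally-minted
statement may enter as a cited fact. Every hypothesis is either kernel-proved in this package or a verbatim quotation of a PUBLISHED theorem with page
reference. The manuscript(s) under audit are NOT citable for their own disputed steps — they are the thing under adjudication; programme-internal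
(2001/route/tribunal) claims are never citable.»  [folklore] composition BY NAME of landed modules (the row-D1 OWNER an2's ROOT chain F′ … M‴ and its letter
dischargers, the β-lead's `ScalewiseVectorSeam`, an4's `HessianTelescopingKKT`); no `def`, no `def … : Prop`, nothing cited, 0 sorry; nothing of Bałaban's
asserted; 0 estimates; 0∕4 row-D1 binders DISCHARGED BY THIS FILE (hW ∕ hR at the locks were already theorems INSIDE M‴'s chain — these files only EXPOSE them;
`D1Tel` ∕ `D1Rep` stay the roads'); ROOT M‴ p325680 untouched; NOT (T-ID), NOT SDF, NOT D1, NOT BetaPertH, NOT continuum, NOT Clay.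
Road «FP» OWNER, b2b-balaban-beta-d1-p3 gen 23, 2026-08-22.  No existing file touched.
-/

noncomputable section

open Finset
open scoped BigOperators
open Literature.MathematicalPhysics.QuantumFieldTheory
open Literature.MathematicalPhysics.QuantumFieldTheory.Balaban1983to89
open Literature.MathematicalPhysics.QuantumFieldTheory.Balaban1983to89.Beta
open ExpKernelCalculus (tadpole)
open PolarizationSign (WardTransversal AxisReflectionCovariant)
open AveragingContoursRooted (ctr)
open OneStepResolventKernel (Fib JetData)
open OneStepKernelFamily (TbalOf flipK D1Tel)
open BalabanStepJetsSucc (wE wVH)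
open BalabanStepW2 (wV4)
open Summit.QuantumFields.BalabanUV.Beta.TameKernelCalculus
open Summit.QuantumFields.BalabanUV.Beta.ChartConjugation (conjV)
open Summit.QuantumFields.BalabanUV.Beta.AxialDressingRooted (one_le_of_neZero)
open Summit.QuantumFields.BalabanUV.Beta.CombChartStepJets (GcombSh)
open Summit.QuantumFields.BalabanUV.Beta.CombChartJointEnd (JsB12CombShSym)
open Summit.QuantumFields.BalabanUV.Beta.SymShiftedSpread (bhKStepSh)
open Summit.QuantumFields.BalabanUV.Beta.BorderedHessian (bhK stepScale diagK)
open Summit.QuantumFields.BalabanUV.Beta.E3ContactGenerator (ctGenM)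
open Summit.QuantumFields.BalabanUV.Beta.DshAn1 (Dsh)
open Summit.QuantumFields.BalabanUV.Beta.SymAveragingMixedJetTables (symMixFFAt)
open Summit.QuantumFields.BalabanUV.Beta.SymSecondOrderTablesAn1 (symVh₂SAn1 symTablesAn1S2 locStencil₂_symVh₂SAn1 symVh₂SAn1_hBt symVh₂SAn1_inl_inl symMixFFAt_hmix_ctr symMixFFAt_hmixt)
open Summit.QuantumFields.BalabanUV.Beta.SymMixedReflectionLetterAn1 (symRMrAn1 hM2_symMixFFAt)
open Summit.QuantumFields.BalabanUV.Beta.CombSecondOrderRemainderAn1 (combΔAn1)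
open Summit.QuantumFields.BalabanUV.Beta.RowD1JointEndSymReflTablesAn1S2Z (loc_diagK_zeroTable)
open Summit.QuantumFields.BalabanUV.Beta.SymSecondOrderTablesAn1 (symVh₂SAn1 symTablesAn1S2)
open Summit.QuantumFields.BalabanUV.Beta.CombSecondOrderRemainderAn1 (combR2An1 combΔAn1)
open Summit.QuantumFields.BalabanUV.Beta.CombSecondOrderDeltaSep (hΔL_pinned)
open OneStepResolventKernel (Fib)
open BalabanStepJetsSucc (wVH)
open Summit.QuantumFields.BalabanUV.Beta.SymSecondOrderTablesAn1 (symVh₂SAn1)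
open Summit.QuantumFields.BalabanUV.Beta.SymMixedReflectionLetterAn1 (symRMrAn1)
open Summit.QuantumFields.BalabanUV.Beta.CombSecondOrderRemainderAn1 (combR2An1 combΔAn1 hR2succ_comb)
open Summit.QuantumFields.BalabanUV.Beta.SymSecondOrderTablesAn1 (symTablesAn1S2)
open OneStepResolventKernel (JetData)
open OneStepKernelFamily (D1Tel)
open Summit.QuantumFields.BalabanUV.Beta.SymWardLettersAn1 (symRMAn1 hcls_sym hRBp_zero hRMp_sym_of_lock hBord0_sym hBord0''_sym hBordS_sym hBordS''_sym hM₂_sym)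
open Summit.QuantumFields.BalabanUV.Beta.SymVhSliceReflectionAn1 (hVfm_sym hVmf_sym hVmm_sym)
open Summit.QuantumFields.BalabanUV.Beta.SymRootedKernelReflection (hHr_sym)
open Summit.QuantumFields.BalabanUV.Beta.CombBorderReflectionLetters (hBfm_comb hBmf_comb hBmm_comb)
open Summit.QuantumFields.BalabanUV.Beta.SymBorderReflectionLetters (hRBrff_zero)
open Summit.QuantumFields.BalabanUV.Beta.CombSecondOrderRemainderAn1 (combR2An1 combΔAn1 h0_comb hsplit_comb hR2succ_comb)
open Summit.QuantumFields.BalabanUV.Beta.CombDressedResponseLoc (hDg_comb)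
open ScalewiseVectorSeam (scalewiseData_of_printed_flip)
open OneStepKernelFamily (hdec_TbalOf TshotOf)
open DecimatedMomentSummable (AbsMoment₂)
open HessianTelescopingKKT (StepRecursion wStep d1Tel_of_stepRecursion_wStep)
open DressedMomentNormalisation (EKer dressedEntry)
open Summit.QuantumFields.BalabanUV.Beta.FP.StepRecursionFeed (d1Tel_JcOf_of_kernel_laws_wStep d1Tel_anchored_of_kernel_laws_wStep)
open Summit.QuantumFields.BalabanUV.Beta.CombOneShotJets (JcOf TshotOf_JcOf_one)
open Summit.QuantumFields.BalabanUV.Beta.CombRemainderParityAll (hRm0_discharged)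
open Summit.QuantumFields.BalabanUV.Beta.FP.StepKernelWardDataReflTablesAn1 (wardRefl_JsB12CombShSym_an1Tables_of_bordMixLetters_reflTableLettersRem)

namespace Summit.QuantumFields.BalabanUV.Beta.FP.StepKernelWardDataRecord

variable {Lc : ℕ} [NeZero Lc]

/-! ## §1 hW ∧ hR at the pinned (III′) literal: the substitution levels of the ROOT chain composed, then `…S2Z`, `…S2N`, M‴ -/

/-- [folklore] **hW ∧ hR TWIN of `CombChartJointEndReflTablesAn1S2RD.d1Drift_JsB12CombShSym_an1TablesS2_of_locks_contact_splitLoc_hcomp_D1Tel_D1Rep`, WITH THE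
SUBSTITUTION-ONLY ROOTS `…An1S2` (an1's second-order tables), `…S2M` (`symRMrAn1`, `hM2_symMixFFAt`), `…S2MW` (the `_sym` border∕mixed Ward table letters at the locks),
`…S2MWV` (`hVfm_sym hVmf_sym hVmm_sym hHr_sym`, `hlock2`), `…S2MWVB` (the PINNED first-order contacts: `hBfm_comb hBmf_comb hBmm_comb`, `RBr := 0`) and `…S2R`
(`combR2An1 h0_comb combΔAn1 hsplit_comb hR2succ_comb`) COMPOSED** into ONE application of #30c's twin — every argument the term the corresponding root passes, BY NAME.
Displayed, exactly as in that root: the locks `hΛ hcB`, the contact coefficient `γ` with `hγ`, the cross table `X2s` with `hX2L`, `hΔL`, `hRm0`. -/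
theorem wardRefl_JsB12CombShSym_an1TablesS2_of_locks_contact_splitLoc_hcomp (hLc : Odd Lc) (hL2 : 2 ≤ Lc) {N : ℕ} (hN : 2 ≤ N) (cΛ cB : ℝ)
    -- the two unit locks of an1's TABLE-FIT tier 2 (Λ-lock of `SymMixedWardSiteLaw.symBondWardM`, B-lock of `SymBorderWardSiteLaw.symBondWardB`)
    (hΛ : cΛ * (Lc : ℝ) ^ 4 = 2) (hcB : cB = -((Lc : ℝ) ^ 12 / 4))
    -- the first-order contact coefficient, displayed
    (γ : ℕ → ℝ) (hγ : ∀ j, γ j = -((Lc : ℝ) ^ 8 / 2) * wVH 3 Lc j / (stepScale 3 Lc j * (Lc : ℝ) ^ 4))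
    -- hR, SECOND ORDER: the contact table `X2s` (free) with its localisation, and the localisation of the defined split defect
    (X2s : ℕ → Fin 4 → Fin 4 → (Fin 4 → ℤ) → Fin 4 → (Fin 4 → ℤ) → (Fin 4 → ℤ) → Fib 3 → ℝ)
    (hX2L : ∀ j α μ y ν y', Loc (diagK (X2s j α μ y ν y'))) (hΔL : ∀ j α μ y ν y', Loc (combΔAn1 Lc N cΛ γ X2s j α μ y ν y'))
    -- the cancellation of the chart-(II) defect against the W-REMAINDER `Rm_j` (the compensator is now IDENTIFIED: `Wc := Rm`, `X₂ := diagK X2s`) — the (N8) object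
    (hRm0 : ∀ (j : ℕ) (α μ : Fin 4) (y : Fin 4 → ℤ) (ν : Fin 4) (y' : Fin 4 → ℤ),
      tadpole (GcombSh Lc j)
        ((1 / 2 : ℝ) • conjV (bhKStepSh 3 Lc (Dsh Lc) j) (diagK fun p a => X2s j α ν y' μ y p a - X2s j α μ y ν y' p a) +
          (1 / 2 : ℝ) • (combΔAn1 Lc N cΛ γ X2s j α μ y ν y' + combΔAn1 Lc N cΛ γ X2s j α ν y' μ y)) = 0) :
    (∀ j : ℕ, WardTransversal (flipK (TbalOf Lc (JsB12CombShSym hLc N (symTablesAn1S2 3 Lc cΛ) cΛ cB) j))) ∧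
      (∀ j : ℕ, AxisReflectionCovariant (flipK (TbalOf Lc (JsB12CombShSym hLc N (symTablesAn1S2 3 Lc cΛ) cΛ cB) j))) := by
  subst hcB
  have hLc1 : 1 ≤ Lc := le_trans one_le_two hL2
  have hlock2 : ∀ j : ℕ, ((Lc : ℝ) ^ 8) * wV4 3 Lc (j + 1) * wVH 3 Lc (j + 1) = ((Lc : ℝ) ^ 4 * wE 3 Lc (j + 1)) ^ 2 := fun j => by
    simp only [BalabanStepW2.wV4, BalabanStepJetsSucc.wVH, BalabanStepJetsSucc.wE]
    ring
  exact wardRefl_JsB12CombShSym_an1Tables_of_bordMixLetters_reflTableLettersRem hLc hN cΛ (-((Lc : ℝ) ^ 12 / 4))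
    (symVh₂SAn1 3 Lc) (symMixFFAt (ctr 4 Lc) Lc) (locStencil₂_symVh₂SAn1 (one_le_of_neZero Lc)) (symMixFFAt_hmix_ctr (one_le_of_neZero Lc))
    (symVh₂SAn1_hBt (one_le_of_neZero Lc)) (symMixFFAt_hmixt (ctr 4 Lc) Lc)
    0 0 (symRMAn1 Lc cΛ) (hcls_sym hLc1 cΛ 0) (fun j => hcls_sym hLc1 cΛ (j + 1)) hRBp_zero hRBp_zero (hRMp_sym_of_lock hΛ)
    (hBord0_sym hLc) (hBord0''_sym hLc) (hBordS_sym hLc) (hBordS''_sym hLc) (hM₂_sym cΛ)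
    (hVfm_sym hLc) (hVmf_sym hLc) (hVmm_sym hLc) (hHr_sym hLc) γ hγ
    (fun κ u κ' u' x z β β' => symVh₂SAn1_inl_inl Lc κ u κ' u' x z β β') hlock2
    (fun j α κ u κ' u' p c => (γ j * ctGenM 3 (bhK Lc + Dsh Lc) α Lc κ u p c) * (γ j * ctGenM 3 (bhK Lc + Dsh Lc) α Lc κ' u' p c))
    (combR2An1 Lc N cΛ γ X2s) (symRMrAn1 Lc cΛ γ) (h0_comb N cΛ γ X2s) (hM2_symMixFFAt hLc cΛ γ)
    X2s (combΔAn1 Lc N cΛ γ X2s) (hsplit_comb N cΛ γ X2s) (hDg_comb cΛ γ) hX2L hΔL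
    0 hRBrff_zero (hBfm_comb hLc cΛ γ hγ) (hBmf_comb hLc cΛ γ hγ) (hBmm_comb cΛ γ) (hR2succ_comb N cΛ γ X2s) hRm0


/-- [folklore] **hW ∧ hR TWIN of `CombChartJointEndReflTablesAn1S2Z.d1Drift_JsB12CombShSym_an1TablesS2_pinned_of_locks_splitLoc_hcomp_D1Tel_D1Rep`** (ROOT chain F′ … M‴ of row D1, chart (III′)): the SAME letters, the conclusion
replaced by the Ward transversality and the axis-reflection covariance of the flipped step kernels `flipK (TbalOf Lc (JsB12CombShSym …) j)`, every `j`;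
proof = the original body with its callee replaced by the callee's twin (route binders dropped). -/
theorem wardRefl_JsB12CombShSym_an1TablesS2_pinned_of_locks_splitLoc_hcomp (hLc : Odd Lc) (hL2 : 2 ≤ Lc) {N : ℕ} (hN : 2 ≤ N) (cΛ cB : ℝ)
    -- the two unit locks of an1's TABLE-FIT tier 2 (Λ-lock of `SymMixedWardSiteLaw.symBondWardM`, B-lock of `SymBorderWardSiteLaw.symBondWardB`)
    (hΛ : cΛ * (Lc : ℝ) ^ 4 = 2) (hcB : cB = -((Lc : ℝ) ^ 12 / 4))
    -- hR, SECOND ORDER: the localisation of the defined split defect at the pinned contact data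
    (hΔL : ∀ j α μ y ν y', Loc (combΔAn1 Lc N cΛ (fun j => -((Lc : ℝ) ^ 8 / 2) * wVH 3 Lc j / (stepScale 3 Lc j * (Lc : ℝ) ^ 4)) (0 : ℕ → Fin 4 → Fin 4 → (Fin 4 → ℤ) → Fin 4 → (Fin 4 → ℤ) → (Fin 4 → ℤ) → Fib 3 → ℝ) j α μ y ν y'))
    -- the cancellation of the chart-(II) defect against the W-REMAINDER `Rm_j` (`Wc := Rm`, `X₂ := 0`) — the (N8) object
    (hRm0 : ∀ (j : ℕ) (α μ : Fin 4) (y : Fin 4 → ℤ) (ν : Fin 4) (y' : Fin 4 → ℤ),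
      tadpole (GcombSh Lc j)
        ((1 / 2 : ℝ) • conjV (bhKStepSh 3 Lc (Dsh Lc) j) (diagK fun p a => (0 : ℕ → Fin 4 → Fin 4 → (Fin 4 → ℤ) → Fin 4 → (Fin 4 → ℤ) → (Fin 4 → ℤ) → Fib 3 → ℝ) j α ν y' μ y p a - (0 : ℕ → Fin 4 → Fin 4 → (Fin 4 → ℤ) → Fin 4 → (Fin 4 → ℤ) → (Fin 4 → ℤ) → Fib 3 → ℝ) j α μ y ν y' p a) +
          (1 / 2 : ℝ) • (combΔAn1 Lc N cΛ (fun j => -((Lc : ℝ) ^ 8 / 2) * wVH 3 Lc j / (stepScale 3 Lc j * (Lc : ℝ) ^ 4)) (0 : ℕ → Fin 4 → Fin 4 → (Fin 4 → ℤ) → Fin 4 → (Fin 4 → ℤ) → (Fin 4 → ℤ) → Fib 3 → ℝ) j α μ y ν y' + combΔAn1 Lc N cΛ (fun j => -((Lc : ℝ) ^ 8 / 2) * wVH 3 Lc j / (stepScale 3 Lc j * (Lc : ℝ) ^ 4)) (0 : ℕ → Fin 4 → Fin 4 → (Fin 4 → ℤ) → Fin 4 → (Fin 4 → ℤ) → (Fin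 4 → ℤ) → Fib 3 → ℝ) j α ν y' μ y)) = 0) :
    (∀ j : ℕ, WardTransversal (flipK (TbalOf Lc (JsB12CombShSym hLc N (symTablesAn1S2 3 Lc cΛ) cΛ cB) j))) ∧
      (∀ j : ℕ, AxisReflectionCovariant (flipK (TbalOf Lc (JsB12CombShSym hLc N (symTablesAn1S2 3 Lc cΛ) cΛ cB) j))) := by
  exact wardRefl_JsB12CombShSym_an1TablesS2_of_locks_contact_splitLoc_hcomp hLc hL2 hN cΛ cB hΛ hcB
    (fun j => -((Lc : ℝ) ^ 8 / 2) * wVH 3 Lc j / (stepScale 3 Lc j * (Lc : ℝ) ^ 4)) (fun _ => rfl) 0 loc_diagK_zeroTable hΔL hRm0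

/-- [folklore] **hW ∧ hR TWIN of `CombChartJointEndReflTablesAn1S2N.d1Drift_JsB12CombShSym_an1TablesS2_pinned_of_locks_hcomp_D1Tel_D1Rep`** (ROOT chain F′ … M‴ of row D1, chart (III′)): the SAME letters, the conclusion
replaced by the Ward transversality and the axis-reflection covariance of the flipped step kernels `flipK (TbalOf Lc (JsB12CombShSym …) j)`, every `j`;
proof = the original body with its callee replaced by the callee's twin (route binders dropped). -/
theorem wardRefl_JsB12CombShSym_an1TablesS2_pinned_of_locks_hcomp (hLc : Odd Lc) (hL2 : 2 ≤ Lc) {N : ℕ} (hN : 2 ≤ N) (cΛ cB : ℝ)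
    -- the two unit locks of an1's TABLE-FIT tier 2
    (hΛ : cΛ * (Lc : ℝ) ^ 4 = 2) (hcB : cB = -((Lc : ℝ) ^ 12 / 4))
    -- the cancellation against the W-REMAINDER `Rm_j` at `X2s := 0` — the repair track's scalar `hRm0` (LOCATED: the (E0) table, HRM0-AN3 §4)
    (hRm0 : ∀ (j : ℕ) (α μ : Fin 4) (y : Fin 4 → ℤ) (ν : Fin 4) (y' : Fin 4 → ℤ),
      tadpole (GcombSh Lc j)
        ((1 / 2 : ℝ) • conjV (bhKStepSh 3 Lc (Dsh Lc) j) (diagK fun p a => (0 : ℕ → Fin 4 → Fin 4 → (Fin 4 → ℤ) → Fin 4 → (Fin 4 → ℤ) → (Fin 4 → ℤ) → Fib 3 → ℝ) j α ν y' μ y p a - (0 : ℕ → Fin 4 → Fin 4 → (Fin 4 → ℤ) → Fin 4 → (Fin 4 → ℤ) → (Fin 4 → ℤ) → Fib 3 → ℝ) j α μ y ν y' p a) +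
          (1 / 2 : ℝ) • (combΔAn1 Lc N cΛ (fun j => -((Lc : ℝ) ^ 8 / 2) * wVH 3 Lc j / (stepScale 3 Lc j * (Lc : ℝ) ^ 4)) (0 : ℕ → Fin 4 → Fin 4 → (Fin 4 → ℤ) → Fin 4 → (Fin 4 → ℤ) → (Fin 4 → ℤ) → Fib 3 → ℝ) j α μ y ν y' + combΔAn1 Lc N cΛ (fun j => -((Lc : ℝ) ^ 8 / 2) * wVH 3 Lc j / (stepScale 3 Lc j * (Lc : ℝ) ^ 4)) (0 : ℕ → Fin 4 → Fin 4 → (Fin 4 → ℤ) → Fin 4 → (Fin 4 → ℤ) → (Fin 4 → ℤ) → Fib 3 → ℝ) j α ν y' μ y)) = 0) :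
    (∀ j : ℕ, WardTransversal (flipK (TbalOf Lc (JsB12CombShSym hLc N (symTablesAn1S2 3 Lc cΛ) cΛ cB) j))) ∧
      (∀ j : ℕ, AxisReflectionCovariant (flipK (TbalOf Lc (JsB12CombShSym hLc N (symTablesAn1S2 3 Lc cΛ) cΛ cB) j))) := by
  exact wardRefl_JsB12CombShSym_an1TablesS2_pinned_of_locks_splitLoc_hcomp hLc hL2 hN cΛ cB hΛ hcB
    (hΔL_pinned N cΛ (fun j => -((Lc : ℝ) ^ 8 / 2) * wVH 3 Lc j / (stepScale 3 Lc j * (Lc : ℝ) ^ 4))) hRm0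

/-- [folklore] **hW ∧ hR TWIN of `CombRemainderParityAll.d1Drift_JsB12CombShSym_an1TablesS2_pinned_of_locks_D1Tel_D1Rep`** (ROOT chain F′ … M‴ of row D1, chart (III′)): the SAME letters, the conclusion
replaced by the Ward transversality and the axis-reflection covariance of the flipped step kernels `flipK (TbalOf Lc (JsB12CombShSym …) j)`, every `j`;
proof = the original body with its callee replaced by the callee's twin (route binders dropped). -/
theorem wardRefl_JsB12CombShSym_an1TablesS2_pinned_of_locks (hLc : Odd Lc) (hL2 : 2 ≤ Lc) {N : ℕ} (hN : 2 ≤ N) (cΛ cB : ℝ)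
    -- the two unit locks of an1's TABLE-FIT tier 2
    (hΛ : cΛ * (Lc : ℝ) ^ 4 = 2) (hcB : cB = -((Lc : ℝ) ^ 12 / 4)) :
    (∀ j : ℕ, WardTransversal (flipK (TbalOf Lc (JsB12CombShSym hLc N (symTablesAn1S2 3 Lc cΛ) cΛ cB) j))) ∧
      (∀ j : ℕ, AxisReflectionCovariant (flipK (TbalOf Lc (JsB12CombShSym hLc N (symTablesAn1S2 3 Lc cΛ) cΛ cB) j))) :=
  wardRefl_JsB12CombShSym_an1TablesS2_pinned_of_locks_hcomp hLc hL2 hN cΛ cB hΛ hcB (hRm0_discharged (Lc := Lc) hLc hN hΛ)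

/-! ## §2 The per-step data (hTA, (T0), (T1)) of the (III′) literal of record, DISCHARGED -/

/-- [folklore] **hTA ∧ (T0) ∧ (T1) FOR THE STEP KERNELS OF THE (III′) LITERAL OF RECORD** (`Odd Lc`, `2 ≤ Lc`, `2 ≤ N`, the two unit locks `hΛ hcB` of M‴ — nothing
else): absolutely summable second moments, vanishing zeroth moments and vanishing first moments of every channel of
`TbalOf Lc (JsB12CombShSym hLc N (symTablesAn1S2 3 Lc cΛ) cΛ cB) j`, every `j` — the β-lead's `ScalewiseVectorSeam.scalewiseData_of_printed_flip` at the uniform decay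
`hdec_TbalOf` and §1's hW ∧ hR (`RowD1Telescoping.stepData_JsRowD1Pin`'s pattern, for the newer literal). -/
theorem stepData_JsB12CombShSym_an1S2_pinned (hLc : Odd Lc) (hL2 : 2 ≤ Lc) {N : ℕ} (hN : 2 ≤ N) (cΛ cB : ℝ)
    (hΛ : cΛ * (Lc : ℝ) ^ 4 = 2) (hcB : cB = -((Lc : ℝ) ^ 12 / 4)) :
    (∀ j (c e : Fin 4), AbsMoment₂ (TbalOf Lc (JsB12CombShSym hLc N (symTablesAn1S2 3 Lc cΛ) cΛ cB) j c e)) ∧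
      (∀ j (c e : Fin 4), HasSum (TbalOf Lc (JsB12CombShSym hLc N (symTablesAn1S2 3 Lc cΛ) cΛ cB) j c e) 0) ∧
        (∀ j (c e ρ : Fin 4), HasSum (fun t : Fin 4 → ℤ => t ρ • TbalOf Lc (JsB12CombShSym hLc N (symTablesAn1S2 3 Lc cΛ) cΛ cB) j c e t) 0) :=
  scalewiseData_of_printed_flip (hdec_TbalOf (JsB12CombShSym hLc N (symTablesAn1S2 3 Lc cΛ) cΛ cB))
    (wardRefl_JsB12CombShSym_an1TablesS2_pinned_of_locks hLc hL2 hN cΛ cB hΛ hcB).1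
    (wardRefl_JsB12CombShSym_an1TablesS2_pinned_of_locks hLc hL2 hN cΛ cB hΛ hcB).2

/-- [folklore] (T0) of the step kernels of the (III′) literal of record — #28 §5's `hT0` VERBATIM, now a theorem. -/
theorem stepT0_JsB12CombShSym_an1S2_pinned (hLc : Odd Lc) (hL2 : 2 ≤ Lc) {N : ℕ} (hN : 2 ≤ N) (cΛ cB : ℝ)
    (hΛ : cΛ * (Lc : ℝ) ^ 4 = 2) (hcB : cB = -((Lc : ℝ) ^ 12 / 4)) :
    ∀ j (c e : Fin 4), HasSum (TbalOf Lc (JsB12CombShSym hLc N (symTablesAn1S2 3 Lc cΛ) cΛ cB) j c e) 0 :=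
  (stepData_JsB12CombShSym_an1S2_pinned hLc hL2 hN cΛ cB hΛ hcB).2.1

/-- [folklore] (T1) of the step kernels of the (III′) literal of record — #28 §5's `hT1` VERBATIM, now a theorem. -/
theorem stepT1_JsB12CombShSym_an1S2_pinned (hLc : Odd Lc) (hL2 : 2 ≤ Lc) {N : ℕ} (hN : 2 ≤ N) (cΛ cB : ℝ)
    (hΛ : cΛ * (Lc : ℝ) ^ 4 = 2) (hcB : cB = -((Lc : ℝ) ^ 12 / 4)) :
    ∀ j (c e ρ : Fin 4), HasSum (fun t : Fin 4 → ℤ => t ρ • TbalOf Lc (JsB12CombShSym hLc N (symTablesAn1S2 3 Lc cΛ) cΛ cB) j c e t) 0 :=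
  (stepData_JsB12CombShSym_an1S2_pinned hLc hL2 hN cΛ cB hΛ hcB).2.2

/-- [folklore] hTA (absolutely summable second moments) of the step kernels of the (III′) literal of record (also an4's `hTA_TbalOf` — here in the bundle). -/
theorem stepTA_JsB12CombShSym_an1S2_pinned (hLc : Odd Lc) (hL2 : 2 ≤ Lc) {N : ℕ} (hN : 2 ≤ N) (cΛ cB : ℝ)
    (hΛ : cΛ * (Lc : ℝ) ^ 4 = 2) (hcB : cB = -((Lc : ℝ) ^ 12 / 4)) :
    ∀ j (c e : Fin 4), AbsMoment₂ (TbalOf Lc (JsB12CombShSym hLc N (symTablesAn1S2 3 Lc cΛ) cΛ cB) j c e) :=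
  (stepData_JsB12CombShSym_an1S2_pinned hLc hL2 hN cΛ cB hΛ hcB).1

/-! ## §3 Road «FP» #28 §5 RE-CUT: M‴'s `htel` at the (III′) literal from (L1)(L2′) ONLY (+ M‴'s own locks) — (L3′) and (L4′) discharged -/

/-- [folklore] **`D1Tel` AT THE (III′) LITERAL OF RECORD FROM THE ROAD's KERNEL ROWS (L1)(L2′) ALONE** — #28 `StepRecursionFeed.d1Tel_JcOf_of_kernel_laws_wStep` with
its (L4′) side binders `hT0 hT1` SUPPLIED by §2 (the (L3′) base identity was already an2's `TshotOf_JcOf_one` inside #28).  Displayed: (L1) the de-periodised door per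
`j ≥ 1`, (L2′) the three identifications at the canonical weight `wStep Lc`, and the scalars M‴ displays anyway (`Odd Lc`, `2 ≤ Lc`, `2 ≤ N`, `hΛ`, `hcB`). -/
theorem d1Tel_JcOf_of_kernel_laws_wStep_pinned (hLc : Odd Lc) (hL2 : 2 ≤ Lc) {N : ℕ} (hN : 2 ≤ N) (cΛ cB : ℝ)
    (hΛ : cΛ * (Lc : ℝ) ^ 4 = 2) (hcB : cB = -((Lc : ℝ) ^ 12 / 4)) (𝒦N 𝒦F 𝒦G : ℕ → EKer 4)
    (hlaw : ∀ j : ℕ, 1 ≤ j → ∀ (a b : Fin 4) (z : Fin 4 → ℤ), 𝒦N j a b z = 𝒦F j a b z + 𝒦G j a b z)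
    (hN' : ∀ j : ℕ, 1 ≤ j → ∀ (a b : Fin 4) (z : Fin 4 → ℤ),
      𝒦N j a b z = TshotOf Lc (JcOf hLc N (fun _ => cΛ) (fun _ => cB)) (j + 1) a b z)
    (hF : ∀ j : ℕ, 1 ≤ j → ∀ (a b : Fin 4) (z : Fin 4 → ℤ),
      𝒦F j a b z = (Lc : ℝ) ^ 8 * dressedEntry (wStep Lc j) (TshotOf Lc (JcOf hLc N (fun _ => cΛ) (fun _ => cB)) j) ((Lc : ℤ) • z) a b)
    (hG : ∀ j : ℕ, 1 ≤ j → ∀ (a b : Fin 4) (z : Fin 4 → ℤ),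
      𝒦G j a b z = TbalOf Lc (JsB12CombShSym hLc N (symTablesAn1S2 3 Lc cΛ) cΛ cB) j a b z) :
    D1Tel Lc (JsB12CombShSym hLc N (symTablesAn1S2 3 Lc cΛ) cΛ cB) (JcOf hLc N (fun _ => cΛ) (fun _ => cB)) :=
  d1Tel_JcOf_of_kernel_laws_wStep hLc N cΛ cB 𝒦N 𝒦F 𝒦G hlaw hN' hF hG (stepT0_JsB12CombShSym_an1S2_pinned hLc hL2 hN cΛ cB hΛ hcB)
    (stepT1_JsB12CombShSym_an1S2_pinned hLc hL2 hN cΛ cB hΛ hcB)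

/-- [folklore] **THE SAME FOR ANY COMPOSITE FAMILY ANCHORED AT `m = 1`** (R-D1-g42-4 (3): the `Jc` of record is the composite-contour literal `JcComp`, anchored on
`JcOf` at `m = 1`) — #28's `d1Tel_anchored_of_kernel_laws_wStep` with `hT0 hT1` SUPPLIED by §2: M‴'s `htel` for such a `Jc` from (L1)(L2′) + the anchor `hJc1`
ONLY (+ M‴'s own scalars). -/
theorem d1Tel_anchored_of_kernel_laws_wStep_pinned (hLc : Odd Lc) (hL2 : 2 ≤ Lc) {N : ℕ} (hN : 2 ≤ N) (cΛ cB : ℝ)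
    (hΛ : cΛ * (Lc : ℝ) ^ 4 = 2) (hcB : cB = -((Lc : ℝ) ^ 12 / 4)) (Jc : ∀ m : ℕ, JetData 3 (Lc ^ m))
    (hJc1 : Jc 1 = JcOf hLc N (fun _ => cΛ) (fun _ => cB) 1) (𝒦N 𝒦F 𝒦G : ℕ → EKer 4)
    (hlaw : ∀ j : ℕ, 1 ≤ j → ∀ (a b : Fin 4) (z : Fin 4 → ℤ), 𝒦N j a b z = 𝒦F j a b z + 𝒦G j a b z)
    (hN' : ∀ j : ℕ, 1 ≤ j → ∀ (a b : Fin 4) (z : Fin 4 → ℤ), 𝒦N j a b z = TshotOf Lc Jc (j + 1) a b z)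
    (hF : ∀ j : ℕ, 1 ≤ j → ∀ (a b : Fin 4) (z : Fin 4 → ℤ),
      𝒦F j a b z = (Lc : ℝ) ^ 8 * dressedEntry (wStep Lc j) (TshotOf Lc Jc j) ((Lc : ℤ) • z) a b)
    (hG : ∀ j : ℕ, 1 ≤ j → ∀ (a b : Fin 4) (z : Fin 4 → ℤ),
      𝒦G j a b z = TbalOf Lc (JsB12CombShSym hLc N (symTablesAn1S2 3 Lc cΛ) cΛ cB) j a b z) :
    D1Tel Lc (JsB12CombShSym hLc N (symTablesAn1S2 3 Lc cΛ) cΛ cB) Jc :=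
  d1Tel_anchored_of_kernel_laws_wStep hLc N cΛ cB Jc hJc1 𝒦N 𝒦F 𝒦G hlaw hN' hF hG (stepT0_JsB12CombShSym_an1S2_pinned hLc hL2 hN cΛ cB hΛ hcB)
    (stepT1_JsB12CombShSym_an1S2_pinned hLc hL2 hN cΛ cB hΛ hcB)

/-- [folklore] **`D1Tel` AT THE (III′) LITERAL FROM an4's `StepRecursion` ALONE** — the kernel-level (F1) target of R-FP-57 in ONE hypothesis: `StepRecursion Lc (TbalOf …)
(TshotOf Lc Jc) (wStep Lc)` for any `Jc` anchored on `JcOf` at `m = 1` ⟹ M‴'s `htel` (an4's `d1Tel_of_stepRecursion_wStep` with (T0)(T1) from §2 and `hbase` through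
the anchor + an2's `TshotOf_JcOf_one`). -/
theorem d1Tel_anchored_of_stepRecursion_wStep_pinned (hLc : Odd Lc) (hL2 : 2 ≤ Lc) {N : ℕ} (hN : 2 ≤ N) (cΛ cB : ℝ)
    (hΛ : cΛ * (Lc : ℝ) ^ 4 = 2) (hcB : cB = -((Lc : ℝ) ^ 12 / 4)) (Jc : ∀ m : ℕ, JetData 3 (Lc ^ m))
    (hJc1 : Jc 1 = JcOf hLc N (fun _ => cΛ) (fun _ => cB) 1)
    (hrec : StepRecursion Lc (TbalOf Lc (JsB12CombShSym hLc N (symTablesAn1S2 3 Lc cΛ) cΛ cB)) (TshotOf Lc Jc) (wStep Lc)) :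
    D1Tel Lc (JsB12CombShSym hLc N (symTablesAn1S2 3 Lc cΛ) cΛ cB) Jc := by
  have hbase : TshotOf Lc Jc 1 = TbalOf Lc (JsB12CombShSym hLc N (symTablesAn1S2 3 Lc cΛ) cΛ cB) 0 := by
    have h1 : TshotOf Lc Jc 1 = TshotOf Lc (JcOf hLc N (fun _ => cΛ) (fun _ => cB)) 1 := by
      show OneStepResolventKernel.TOf (N := Lc ^ 1) (Jc 1) = OneStepResolventKernel.TOf (N := Lc ^ 1) (JcOf hLc N (fun _ => cΛ) (fun _ => cB) 1)
      rw [hJc1]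
    exact h1.trans (TshotOf_JcOf_one hLc N (fun _ => cΛ) (fun _ => cB))
  exact d1Tel_of_stepRecursion_wStep _ Jc (stepT0_JsB12CombShSym_an1S2_pinned hLc hL2 hN cΛ cB hΛ hcB)
    (stepT1_JsB12CombShSym_an1S2_pinned hLc hL2 hN cΛ cB hΛ hcB) hbase hrec

end Summit.QuantumFields.BalabanUV.Beta.FP.StepKernelWardDataRecord

end
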